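import Summits.HodgeConjecture.HodgeConjecture.Theorems.Ring2AbelianAllFermatQuotientCharactersSixfolds
import Literature.AlgebraicGeometry.HodgeTheory.FermatShiodaConditionEighteen
import HarnessLib

/-!
# Fermat-quotient characters of NEW non-simple NON-SPLIT metacyclic habitats over bases of genus ≥ 1 — MetacyclicHigherGenus (WEIL-2 gen 33, FERMAT-G33 §3 TABLE Q; fact-free core)

research route, not a corollary; conditional on HC_CM plus one named minimal statement.

Cell `pub-hodge-ring2-ab-*` (ALL ABELIAN VARIETIES), seat WEIL-2 gen 33, account
`run/shared/lean/pub/pub-hodge-ring2/pub-hodge-ring2-ab-weil-2/FERMAT-G33.md` §3 (TABLE Q FINAL: kit jobs j178586 / j179270, scan `code/g32/meta_q/`,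
harvest with the column `e = gcd(f, X-data)` `code/g33/meta_q/harvest_q2.py`), building on FERMAT-G32 §2 THEOREM F_q (base genus `q`, hypothesis
(H): `e = 1`) — SOUND / referee-re-derived (ab-ref R-120).

Informal setting (not formalised; the geometry has no carriers here).  For a metacyclic Galois cover `C̃ → ℙ¹` with group `ℤ/f ⋊ ⟨u⟩` (`⟨u⟩ =
Gal(ℚ(ζ_f)/K)`-part) and `t` branch points of `H`-type, the `N = ℤ/f`-quotient `X = C̃/N` is a curve of genus `q ≥ 1`; THEOREM F_q applied to the
cyclic cover `C̃ → X` (exponent multiset `α` = «X-data», `b` entries, `e = gcd(f, α) = 1` for every type in THIS file) says that Weil's structure on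
the `N`-primitive Prym is generated by algebraic cycles as soon as `α` is a cycle character of the Fermat variety `X^{b−2}_f`, and then `W_K` of the
Hecke `K`-piece is algebraic (gen 5 Cor D.1, FERMAT-G31 LEMMA 3.2).  Listed: the X-data of the types found NON-SIMPLE, `E`-balanced, with a NON-SPLIT
`(n,n)` `K`-piece — each (i) a Hodge multiset and (ii) in every `IsShiodaClosed` family (explicit pair / Lefschetz 4-set / semi 6-set / juxtaposition
term, or the tree's kernel-checked `(P_f)` where the scan's witness uses a type-I step).  Statements already in the tree (the same multiset occurs as
a sphere type of TABLE M or a (3,3) type) are not repeated.  Helpers `star_eq` / `pair_eq` from `Ring2AbelianAllFermatQuotientCharactersSixfolds`.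
0 sorry, no `def`, no named fact; `HC_CM` does not occur.  All proofs are `decide` on explicit finite data.
-/

open Multiset
open Literature.AlgebraicGeometry.HodgeTheory.FermatCharacter
open Summit.HodgeConjecture.Ring2AbelianAll.FermatQuotientCharactersSixfolds (star_eq pair_eq)

namespace Summit.HodgeConjecture.Ring2AbelianAll.FermatQuotientCharactersMetacyclicHigherGenus

/-- `[1^1 7^1 9^1 12^2 13^1]`, `m = 18`: a Hodge multiset — a Hodge character of the Fermat variety `X^4_18` (`b = 6`) for `α` and its unit multiples
(⟺ Weil type `(3,3)`, Schoen Cor. 1.9).  ℚ(√−3): G = ℤ/18 ⋊ ⟨7⟩ cover of ℙ¹ with 4 branch points, e.g. [x^1, x^3s7, x^4s7, x^10s7] (genus 43; 2 structures); X = C̃/N of genus q = 1 (t = 3 H-type points), b = 6; K-piece (3,3), class -[2] (NON-SPLIT); data non-simple, e = gcd(f, X-data) = 1 (hypothesis (H)); family dimension 1 (FERMAT-G33 §3 TABLE Q, kit j179270).  The SAME multiset is also the X-data of the NEW habitat(s) (4,4) q=2 t=4 (g=61, class +[2,3], 4 structures) of the same group (same `b`), certified by the same two theorems.  [locator FERMAT-G33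 §3 TABLE Q]
research route, not a corollary; conditional on HC_CM plus one named minimal statement. -/
theorem isHodgeMultiset_1_7_9_12_12_13 : IsHodgeMultiset ({1, 7, 9, 12, 12, 13} : Multiset (ZMod 18)) := by
  unfold IsHodgeMultiset mNormSum; decide

/-- `[1^1 7^1 9^1 12^2 13^1]`, `m = 18`: in every `IsShiodaClosed` family, via the tree's kernel-checked `(P_18)` (`shiodaCondition_eighteen`) and Shioda's inductive spine
(`IsShiodaClosed.of_shiodaCondition`); the scan's witness was `hash_e=2(surface[2, 9, 12, 13] # surface[1, 7, 12, 16])` (type-I `#` steps are not rendered as terms here); THEOREM F_1's cycle input.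
[locator FERMAT-G33 §3 TABLE Q]  research route, not a corollary; conditional on HC_CM plus one named minimal statement. -/
theorem mem_of_isShiodaClosed_1_7_9_12_12_13 {C : Multiset (ZMod 18) → Prop} (hC : IsShiodaClosed C) :
    C ({1, 7, 9, 12, 12, 13} : Multiset (ZMod 18)) :=
  hC.of_shiodaCondition shiodaCondition_eighteen _ (by decide) (by unfold IsHodgeMultiset mNormSum; decide)

/-- `[2^1 6^1 8^1 9^1 14^1 15^1]`, `m = 18`: a Hodge multiset — a Hodge character of the Fermat variety `X^4_18` (`b = 6`) for `α` and its unit multiples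
(⟺ Weil type `(3,3)`, Schoen Cor. 1.9).  ℚ(√−3): G = ℤ/18 ⋊ ⟨7⟩ cover of ℙ¹ with 4 branch points, e.g. [x^2, x^2s7, x^3s7, x^5s7] (genus 43; 2 structures); X = C̃/N of genus q = 1 (t = 3 H-type points), b = 6; K-piece (3,3), class -[2] (NON-SPLIT); data non-simple, e = gcd(f, X-data) = 1 (hypothesis (H)); family dimension 1 (FERMAT-G33 §3 TABLE Q, kit j179270).  The SAME multiset is also the X-data of the NEW habitat(s) (4,4) q=2 t=4 (g=61, class +[2,3], 6 structures) of the same group (same `b`), certified by the same two theorems.  [locator FERMAT-G33 §3 TABLE Q]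
research route, not a corollary; conditional on HC_CM plus one named minimal statement. -/
theorem isHodgeMultiset_2_6_8_9_14_15 : IsHodgeMultiset ({2, 6, 8, 9, 14, 15} : Multiset (ZMod 18)) := by
  unfold IsHodgeMultiset mNormSum; decide

/-- `[2^1 6^1 8^1 9^1 14^1 15^1]`, `m = 18`: in every `IsShiodaClosed` family, via the tree's kernel-checked `(P_18)` (`shiodaCondition_eighteen`) and Shioda's inductive spine
(`IsShiodaClosed.of_shiodaCondition`); the scan's witness was `hash_e=1(surface[1, 6, 14, 15] # surface[2, 8, 9, 17])` (type-I `#` steps are not rendered as terms here); THEOREM F_1's cycle input.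
[locator FERMAT-G33 §3 TABLE Q]  research route, not a corollary; conditional on HC_CM plus one named minimal statement. -/
theorem mem_of_isShiodaClosed_2_6_8_9_14_15 {C : Multiset (ZMod 18) → Prop} (hC : IsShiodaClosed C) :
    C ({2, 6, 8, 9, 14, 15} : Multiset (ZMod 18)) :=
  hC.of_shiodaCondition shiodaCondition_eighteen _ (by decide) (by unfold IsHodgeMultiset mNormSum; decide)

/-- `[3^1 4^1 9^1 10^1 12^1 16^1]`, `m = 18`: a Hodge multiset — a Hodge character of the Fermat variety `X^4_18` (`b = 6`) for `α` and its unit multiples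
(⟺ Weil type `(3,3)`, Schoen Cor. 1.9).  ℚ(√−3): G = ℤ/18 ⋊ ⟨7⟩ cover of ℙ¹ with 4 branch points, e.g. [x^4, x^1s7, x^3s7, x^16s7] (genus 43; 2 structures); X = C̃/N of genus q = 1 (t = 3 H-type points), b = 6; K-piece (3,3), class -[2] (NON-SPLIT); data non-simple, e = gcd(f, X-data) = 1 (hypothesis (H)); family dimension 1 (FERMAT-G33 §3 TABLE Q, kit j179270).  The SAME multiset is also the X-data of the NEW habitat(s) (4,4) q=2 t=4 (g=61, class +[2,3], 6 structures) of the same group (same `b`), certified by the same two theorems.  [locator FERMAT-G33 §3 TABLE Q]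
research route, not a corollary; conditional on HC_CM plus one named minimal statement. -/
theorem isHodgeMultiset_3_4_9_10_12_16 : IsHodgeMultiset ({3, 4, 9, 10, 12, 16} : Multiset (ZMod 18)) := by
  unfold IsHodgeMultiset mNormSum; decide

/-- `[3^1 4^1 9^1 10^1 12^1 16^1]`, `m = 18`: in every `IsShiodaClosed` family, via the tree's kernel-checked `(P_18)` (`shiodaCondition_eighteen`) and Shioda's inductive spine
(`IsShiodaClosed.of_shiodaCondition`); the scan's witness was `hash_e=1(surface[1, 9, 10, 16] # surface[3, 4, 12, 17])` (type-I `#` steps are not rendered as terms here); THEOREM F_1's cycle input.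
[locator FERMAT-G33 §3 TABLE Q]  research route, not a corollary; conditional on HC_CM plus one named minimal statement. -/
theorem mem_of_isShiodaClosed_3_4_9_10_12_16 {C : Multiset (ZMod 18) → Prop} (hC : IsShiodaClosed C) :
    C ({3, 4, 9, 10, 12, 16} : Multiset (ZMod 18)) :=
  hC.of_shiodaCondition shiodaCondition_eighteen _ (by decide) (by unfold IsHodgeMultiset mNormSum; decide)

/-- `[5^1 6^2 9^1 11^1 17^1]`, `m = 18`: a Hodge multiset — a Hodge character of the Fermat variety `X^4_18` (`b = 6`) for `α` and its unit multiples
(⟺ Weil type `(3,3)`, Schoen Cor. 1.9).  ℚ(√−3): G = ℤ/18 ⋊ ⟨7⟩ cover of ℙ¹ with 4 branch points, e.g. [x^5, x^2s7, x^2s7, x^15s7] (genus 43; 2 structures); X = C̃/N of genus q = 1 (t = 3 H-type points), b = 6; K-piece (3,3), class -[2] (NON-SPLIT); data non-simple, e = gcd(f, X-data) = 1 (hypothesis (H)); family dimension 1 (FERMAT-G33 §3 TABLE Q, kit j179270).  The SAME multiset is also the X-data of the NEW habitat(s) (4,4) q=2 t=4 (g=61, class +[2,3], 4 structures) of the same group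 (same `b`), certified by the same two theorems.  [locator FERMAT-G33 §3 TABLE Q]
research route, not a corollary; conditional on HC_CM plus one named minimal statement. -/
theorem isHodgeMultiset_5_6_6_9_11_17 : IsHodgeMultiset ({5, 6, 6, 9, 11, 17} : Multiset (ZMod 18)) := by
  unfold IsHodgeMultiset mNormSum; decide

/-- `[5^1 6^2 9^1 11^1 17^1]`, `m = 18`: in every `IsShiodaClosed` family, via the tree's kernel-checked `(P_18)` (`shiodaCondition_eighteen`) and Shioda's inductive spine
(`IsShiodaClosed.of_shiodaCondition`); the scan's witness was `hash_e=2(surface[2, 6, 11, 17] # surface[5, 6, 9, 16])` (type-I `#` steps are not rendered as terms here); THEOREM F_1's cycle input.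
[locator FERMAT-G33 §3 TABLE Q]  research route, not a corollary; conditional on HC_CM plus one named minimal statement. -/
theorem mem_of_isShiodaClosed_5_6_6_9_11_17 {C : Multiset (ZMod 18) → Prop} (hC : IsShiodaClosed C) :
    C ({5, 6, 6, 9, 11, 17} : Multiset (ZMod 18)) :=
  hC.of_shiodaCondition shiodaCondition_eighteen _ (by decide) (by unfold IsHodgeMultiset mNormSum; decide)

end Summit.HodgeConjecture.Ring2AbelianAll.FermatQuotientCharactersMetacyclicHigherGenus
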